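import Summits.KontsevichZagierPeriods.Zeta5Search.Barrier.ConeGammaLemmaFWinBoxHull

/-!
# ζ(5) search — BARRIER: windowed Lemma F on BOXES — soundness, part 4: the cut form of `winForm` on a box and the box
# theorems `winForm_le_of_wboxCheck` / `phi30_le_of_wboxCheck`

HONEST FRAMING (cell `pub-zeta5`): systematic search; no irrationality claim unless kernel-certified. MODEL-side objects
under Brown–Zudilin's (28)+(30) ((28) observed, not proved): P2 g24's windowed Lemma-F-with-members bound (cert-2 g35's
`winForm`, `phi30_aOfS_le_winForm`) and `Φ = phi30`. This file proves that a successful `wboxCheckN` bounds `winForm` at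
EVERY real direction of the box, hence `Φ(a) ≤ s₀(a)·(p/q)` for every real direction `a` of the closed box whose normalised
parameters lie in the box. Nothing here is about C₀ / C₁ / δ₂₈ (NO γ-statement), any γ of record, the cone's sup, C2 (OPEN),
S-E (CONJECTURED), (TD_A) or `ζ(5)`; records in print UNMOVED. Theory seat cert-2 g36 (item «WINDOWED LEMMA F ON BOXES —
KERNEL»), part 5; the certificates are `ConeGammaLemmaFWinBoxes`.

* `entG_jT` (a member's `J`-functional in hinge form: `E(jT·U) = E(x log x) − E(q_U)`, the linear part vanishing by
  `linOK`), `memTabOKN_spec`, `tabListN_cons`, `tabListN_nonneg`, **`winFormL_eq_cutForm`** / **`winForm_eq_cutForm`**;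
* `h28_aOfS_eq_featVal`, `hh_of_wallOKBox` (the first wall on the whole box), `boxOK8_spec`;
* **`winForm_le_of_wboxCheck`** and **`phi30_le_of_wboxCheck`** (about the duplicate-free checker `wboxCheckN`; by `exact`
  from `phi30_aOfS_le_winForm` = P2 g24's `phi30_le_windows_members` at the normalised direction, every hypothesis
  discharged from the integer box data).
-/

open Finset Set MeasureTheory
open Literature.Analysis.ValidatedNumerics.NumericsMP

namespace Summit.KontsevichZagierPeriods.Zeta5Search.Barrier.ConeGamma

namespace LemmaFWinBox

open LemmaFBox (SC KT lnNat SC_pos coef featVal minNum maxNum sum8 box centre minNum_le le_maxNum centre_mem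
  abs_sub_centre_le abs_le_of_mem mem_log_of_range cast_toNat_of_pos getD_map_range featVal_sub_eq_sum sum8_eq_sum
  aOfS_normalise)
open LemmaFWin (jT dG memShape memT memC winForm winFormL winFormL_eq_winForm zI mem_zI winEnc winEnc_sound cutsOK
  sortedLE_spec mems_spec jT_zero)

/-! ### The cut form of `winForm` on the box -/

/-- **A member's `J`-functional in hinge form**: for a table whose linear part vanishes and whose features are
non-negative at `t`, `E(jT(·,U)) = E(x log x) − E(q_U)` (`U > 0`). -/
theorem entG_jT {T : List (ℤ × List ℤ)} (hlin : linOK T = true) {t : Fin 8 → ℝ} (hnn : ∀ f ∈ T, 0 ≤ featVal f.2 t)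
    {U : ℝ} (hU : 0 < U) : entG T (fun x => jT x U) t = entG T mulLog t - entG T (qH U) t := by
  rw [entG_congr_nonneg hnn (fun x hx => jT_eq_hinge hx hU)]
  have e1 : entG T (fun x => mulLog x + psiH U * x - qH U x) t
      = entG T (fun x => mulLog x + psiH U * x) t - entG T (qH U) t := entG_sub T _ _ t
  have e2 : entG T (fun x => mulLog x + psiH U * x) t = entG T mulLog t + entG T (fun x => psiH U * x) t :=
    entG_add T _ _ t
  have e3 : entG T (fun x => psiH U * x) t = psiH U * entG T (fun x => x) t := entG_const_mul T _ _ t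
  rw [e1, e2, e3, entG_id_of_linOK hlin]; ring

/-- `memTabOKN`: the underlying table, and the linear / non-negativity checks of its duplicate-free form. -/
theorem memTabOKN_spec {lo hi : List ℕ} {vw : Fin 7 × Fin 7} {T : List (ℤ × List ℤ)} (h : memTabOKN lo hi vw = some T) :
    ∃ T₀, memTab lo hi vw.1 vw.2 = some T₀ ∧ T = normTab T₀ ∧ linOK T = true ∧ nonnegOK lo hi T false = true := by
  unfold memTabOKN at h
  cases hm : memTab lo hi vw.1 vw.2 with
  | none => rw [hm] at h; simp at h
  | some T' =>
    rw [hm] at h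
    simp only at h
    by_cases hc : (linOK (normTab T') && nonnegOK lo hi (normTab T') false) = true
    · rw [if_pos hc] at h
      simp only [Option.some.injEq] at h
      subst h
      simp only [Bool.and_eq_true] at hc
      exact ⟨T', rfl, rfl, hc.1, hc.2⟩
    · rw [if_neg hc] at h; simp at h

/-- `tabListN` on a cons. -/
theorem tabListN_cons {lo hi : List ℕ} {vw : Fin 7 × Fin 7} {vws : List (Fin 7 × Fin 7)}
    {Ts : List (List (ℤ × List ℤ))} (h : tabListN lo hi (vw :: vws) = some Ts) :
    ∃ T Ts', memTabOKN lo hi vw = some T ∧ tabListN lo hi vws = some Ts' ∧ Ts = T :: Ts' := by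
  unfold tabListN at h
  cases h1 : memTabOKN lo hi vw with
  | none => rw [h1] at h; simp at h
  | some T =>
    cases h2 : tabListN lo hi vws with
    | none => rw [h1, h2] at h; simp at h
    | some Ts' =>
      rw [h1, h2] at h
      simp only [Option.some.injEq] at h
      exact ⟨T, Ts', rfl, rfl, h.symm⟩

/-- Every table of `tabListN` has non-negative features on the box. -/
theorem tabListN_nonneg {lo hi : List ℕ} : ∀ (mems : List (Fin 7 × Fin 7)) {Ts : List (List (ℤ × List ℤ))},
    tabListN lo hi mems = some Ts → ∀ T ∈ Ts, ∀ f ∈ T, 0 ≤ minNum f.2 lo hi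
  | [], Ts, h => by
    simp only [tabListN, Option.some.injEq] at h
    subst h; simp
  | vw :: vws, Ts, h => by
    obtain ⟨T, Ts', hT, hTs, e⟩ := tabListN_cons h
    subst e
    intro T' hT' f hf
    rcases List.mem_cons.mp hT' with e | hmem
    · subst e
      obtain ⟨T₀, _, _, _, hnn⟩ := memTabOKN_spec hT
      unfold nonnegOK at hnn
      rw [List.all_eq_true] at hnn
      have := hnn f hf
      simp only [Bool.and_eq_true, decide_eq_true_eq] at this
      exact this.1
    · exact tabListN_nonneg vws hTs T' hmem f hf

/-- **`winFormL` in cut form on the box**: `winFormL t = memConst + featRest t` for every `t` of the box. -/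
theorem winFormL_eq_cutForm {lo hi : List ℕ} {D E : ℕ} (hD : 0 < D) (hE : 0 < E) {t : Fin 8 → ℝ}
    (ht : t ∈ box D lo hi) :
    ∀ (cuts : List ℕ) (mems : List (Fin 7 × Fin 7)) {Ts : List (List (ℤ × List ℤ))},
      tabListN lo hi mems = some Ts → cuts.length = mems.length → (∀ A ∈ cuts, 0 < A) →
      winFormL t E cuts mems = memConst E cuts (cntList lo hi mems) + featRest E cuts Ts t
  | [A], [vw], Ts, hTs, _, hA => by
    obtain ⟨T, Ts', hT, hTs', e⟩ := tabListN_cons hTs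
    simp only [tabListN, Option.some.injEq] at hTs'
    subst hTs'; subst e
    obtain ⟨T₀, hmt, hT₀, hlin, hnn⟩ := memTabOKN_spec hT
    have hU : (0 : ℝ) < (A : ℝ) / E := by
      have : (0 : ℝ) < A := by exact_mod_cast hA A (by simp)
      positivity
    have hnn' := nonneg_of_nonnegOK hnn hD ht
    simp only [winFormL, memConst, featRest, cntList, List.map_cons, List.map_nil]
    rw [memC_eq_cntB hmt hD ht, LemmaFWin.memT_eq_memShape, memTab_sound hmt hD ht, ← entG_normTab, ← hT₀,
      entG_jT hlin hnn' hU]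
    ring
  | A :: A' :: As, vw :: vws, Ts, hTs, hlen, hA => by
    obtain ⟨T, Ts', hT, hTs', e⟩ := tabListN_cons hTs
    subst e
    obtain ⟨T₀, hmt, hT₀, hlin, hnn⟩ := memTabOKN_spec hT
    have hApos : (0 : ℝ) < A := by exact_mod_cast hA A (by simp)
    have hA'pos : (0 : ℝ) < A' := by exact_mod_cast hA A' (by simp)
    have hU : (0 : ℝ) < (A : ℝ) / E := by positivity
    have hU' : (0 : ℝ) < (A' : ℝ) / E := by positivity
    have hnn' := nonneg_of_nonnegOK hnn hD ht
    have ih := winFormL_eq_cutForm hD hE ht (A' :: As) vws hTs' (by simpa using hlen) (fun B hB => hA B (by simp [hB]))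
    have hm : ∀ R, memT t vw.1 vw.2 R = entG T (fun x => jT x R) t := fun R => by
      rw [LemmaFWin.memT_eq_memShape, memTab_sound hmt hD ht, ← entG_normTab, ← hT₀]
    simp only [winFormL, memConst, featRest, cntList, List.map_cons] at ih ⊢
    rw [ih, memC_eq_cntB hmt hD ht, hm, hm, entG_jT hlin hnn' hU, entG_jT hlin hnn' hU']
    ring
  | [], mems, _, _, h, _ => by
    cases mems with
    | nil => simp [winFormL, memConst, featRest]
    | cons _ _ => simp at h
  | [A], [], _, _, h, _ => by simp at h
  | [A], _ :: _ :: _, _, _, h, _ => by simp at h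
  | _ :: _ :: _, [], _, _, h, _ => by simp at h

/-- **`winForm` IN CUT FORM on the box** (P2 g24's bound = constant part + hinge sums − tail entropy form):
`winForm t W U p q = cutForm E cuts (cntList lo hi mems) Ts t` for every `t` of the box, with `W = #cuts − 1`,
`U_w = cuts_w/E`, `(p_w, q_w) = mems_w` and the duplicate-free tables `Ts` of `tabListN`. -/
theorem winForm_eq_cutForm {lo hi : List ℕ} {D E : ℕ} (hD : 0 < D) (hE : 0 < E) {t : Fin 8 → ℝ}
    (ht : t ∈ box D lo hi) {cuts : List ℕ} {mems : List (Fin 7 × Fin 7)} {Ts : List (List (ℤ × List ℤ))}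
    (hTs : tabListN lo hi mems = some Ts) {n : ℕ} (hcl : cuts.length = n + 1) (hml : mems.length = n + 1)
    (hA : ∀ A ∈ cuts, 0 < A) :
    winForm t n (fun w => ((cuts.getD w 0 : ℕ) : ℝ) / E) (fun w => (mems.getD w (0, 1)).1)
      (fun w => (mems.getD w (0, 1)).2) = cutForm E cuts (cntList lo hi mems) Ts t := by
  rw [← winFormL_eq_winForm t E n cuts mems hcl hml, cutForm, winFormL_eq_cutForm hD hE ht cuts mems hTs (by omega) hA]

/-! ### The first wall and the box data -/

/-- The 28 forms at `aOfS t` are the pair features `wallVec`. -/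
theorem h28_aOfS_eq_featVal (t : Fin 8 → ℝ) (k : Fin 28) : h28 (aOfS t) k = featVal (wallVec k) t := by
  rw [h28_aOfS]
  fin_cases k <;> simp [wallVec, LemmaFWin.wallForm, featVal_pairVec_nat] <;> ring

/-- **The first wall on the whole box**: `wallOKBox` gives `U₀·h_k(aOfS t) ≤ 1` for all 28 forms at every `t` of the box. -/
theorem hh_of_wallOKBox {lo hi : List ℕ} {E A0 D : ℕ} (h : wallOKBox lo hi E A0 D = true) (hD : 0 < D) (hE : 0 < E)
    {t : Fin 8 → ℝ} (ht : t ∈ box D lo hi) : ∀ k : Fin 28, ((A0 : ℝ) / E) * h28 (aOfS t) k ≤ 1 := by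
  intro k
  unfold wallOKBox at h
  rw [List.all_eq_true] at h
  have hk := h k (List.mem_finRange k)
  rw [decide_eq_true_eq] at hk
  have hD' : (0 : ℝ) < D := by exact_mod_cast hD
  have hE' : (0 : ℝ) < E := by exact_mod_cast hE
  have h1 : featVal (wallVec k) t * D ≤ (maxNum (wallVec k) lo hi : ℝ) := le_maxNum ht _
  have h2 : ((A0 : ℝ)) * (maxNum (wallVec k) lo hi : ℝ) ≤ (E : ℝ) * D := by exact_mod_cast hk
  rw [h28_aOfS_eq_featVal, div_mul_eq_mul_div, div_le_one hE']
  have hA0 : (0 : ℝ) ≤ A0 := Nat.cast_nonneg _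
  nlinarith

/-- `boxOK8`: `D > 0`, `lo₀ = hi₀ = D`, `lo_i ≤ hi_i ≤ D`. -/
theorem boxOK8_spec {D : ℕ} {lo hi : List ℕ} (h : boxOK8 D lo hi = true) :
    0 < D ∧ lo.getD 0 0 = D ∧ hi.getD 0 0 = D ∧ ∀ i : Fin 8, lo.getD i 0 ≤ hi.getD i 0 ∧ hi.getD i 0 ≤ D := by
  simp only [boxOK8, Bool.and_eq_true, decide_eq_true_eq, List.all_eq_true, List.mem_range] at h
  exact ⟨h.1.1.1, h.1.1.2, h.1.2, fun i => h.2 i i.isLt⟩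

/-- The centre's numerators over `2D` are `centrePt`. -/
theorem centre_mul (D : ℕ) (hD : 0 < D) (lo hi : List ℕ) (i : Fin 8) :
    centre D lo hi i * ((2 * D : ℕ) : ℝ) = (((centrePt lo hi).getD i 0 : ℕ) : ℝ) := by
  unfold centrePt
  rw [getD_map_range _ _ i.isLt]
  simp only [centre]
  have h2 : (2 * (D : ℝ)) ≠ 0 := by positivity
  push_cast
  rw [div_mul_cancel₀ _ h2]

/-! ### The box theorems -/

/-- **KERNEL BOX BOUND FOR THE WINDOWED LEMMA F BOUND.** If `wboxCheckN lo hi D E cuts mems p q = true` then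
`winForm t ≤ p/q` for EVERY real direction `t` of the box `lo_i ≤ D·t_i ≤ hi_i` (cuts `cuts/E`, members `mems`). -/
theorem winForm_le_of_wboxCheck {lo hi : List ℕ} {D E : ℕ} {cuts : List ℕ} {mems : List (Fin 7 × Fin 7)} {p : ℤ}
    {q : ℕ} (hc : wboxCheckN lo hi D E cuts mems p q = true) {t : Fin 8 → ℝ} (ht : t ∈ box D lo hi) :
    winForm t (cuts.length - 1) (fun w => ((cuts.getD w 0 : ℕ) : ℝ) / E)
        (fun w => (mems.getD w (0, 1)).1) (fun w => (mems.getD w (0, 1)).2) ≤ (p : ℝ) / q := by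
  unfold wboxCheckN at hc
  simp only [Bool.and_eq_true, decide_eq_true_eq] at hc
  obtain ⟨⟨⟨⟨hbox, hq⟩, hcuts⟩, hwall⟩, hsum⟩ := hc
  obtain ⟨hD, hlo0, hhi0, hle⟩ := boxOK8_spec hbox
  have hle' : ∀ i : Fin 8, lo.getD i 0 ≤ hi.getD i 0 := fun i => (hle i).1
  simp only [cutsOK, Bool.and_eq_true, decide_eq_true_eq] at hcuts
  obtain ⟨⟨⟨⟨⟨hE, hA0⟩, hsort⟩, hlen⟩, hlenpos⟩, hmems⟩ := hcuts
  split at hsum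
  case h_2 => simp at hsum
  rename_i I R hsumm
  rw [decide_eq_true_eq] at hsum
  -- unpack the summary
  unfold wboxSummaryN at hsumm
  split at hsumm
  case h_2 => simp at hsumm
  rename_i I' LD Ts hI hLD hTs
  split at hsumm
  · simp at hsumm
  rename_i g hg
  simp only [Option.some.injEq, Prod.mk.injEq] at hsumm
  obtain ⟨hII, hR⟩ := hsumm
  subst hII
  have hD' : (0 : ℝ) < D := by exact_mod_cast hD
  have hS : (0 : ℝ) < SC := by exact_mod_cast SC_pos
  have hq' : (0 : ℝ) < q := by exact_mod_cast hq
  -- positivity of the cuts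
  have hApos : ∀ A ∈ cuts, 0 < A := by
    intro A hA
    obtain ⟨n, hn, e⟩ := List.getElem_of_mem hA
    have hmono : ∀ m, m < cuts.length → cuts.getD 0 0 ≤ cuts.getD m 0 := by
      intro m hm
      induction m with
      | zero => exact le_rfl
      | succ m ih => exact (ih (by omega)).trans (sortedLE_spec cuts hsort m hm)
    have := hmono n hn
    rw [List.getD_eq_getElem _ _ hn, e] at this
    omega
  -- the centre
  set c := centre D lo hi with hcdef
  have hcmem : c ∈ box D lo hi := centre_mem hD hle'
  have hct : ∀ i : Fin 8, c i * ((2 * D : ℕ) : ℝ) = (((centrePt lo hi).getD i 0 : ℕ) : ℝ) := centre_mul D hD lo hi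
  obtain ⟨_, hcI⟩ := winEnc_sound hI hct
  -- the cut form at `t` and at `c`
  have hcl : cuts.length = (cuts.length - 1) + 1 := by omega
  have hml : mems.length = (cuts.length - 1) + 1 := by omega
  have et := winFormL_eq_winForm t E (cuts.length - 1) cuts mems hcl hml
  have ec := winFormL_eq_winForm c E (cuts.length - 1) cuts mems hcl hml
  rw [← et]; rw [← ec] at hcI
  rw [winFormL_eq_cutForm hD hE ht cuts mems hTs hlen hApos]
  rw [winFormL_eq_cutForm hD hE hcmem cuts mems hTs hlen hApos] at hcI
  -- the hull
  have hinv := cutAcc_sound hD hE (MI.mem_logNat2 SC_pos hLD) hle' cuts Ts none (S := fun _ => 0)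
    (hull_zero D lo hi) hApos (tabListN_nonneg mems hTs) (fun P hP => by simp at hP) hg t ht
  obtain ⟨v, hv, hdiff⟩ := hinv
  simp only [featRestP, zero_add, sub_zero] at hdiff
  -- the slack
  have hterm : ∀ i : Fin 8, (t i - c i) * v i ≤
      (((hi.getD i 0 : ℕ) : ℝ) - ((lo.getD i 0 : ℕ) : ℝ)) / (2 * D) *
        (((max |(getI g i).lo| |(getI g i).hi| : ℤ) : ℝ) / SC) := by
    intro i
    refine (le_abs_self _).trans ?_
    rw [abs_mul]
    refine mul_le_mul (abs_sub_centre_le hD ht i) (abs_le_of_mem (hv i)) (abs_nonneg _) ?_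
    have := (hle i).1
    have : ((lo.getD i 0 : ℕ) : ℝ) ≤ ((hi.getD i 0 : ℕ) : ℝ) := by exact_mod_cast this
    exact div_nonneg (by linarith) (by positivity)
  have hslack : featRest E cuts Ts t - featRest E cuts Ts c ≤ (R : ℝ) / (2 * D) / SC := by
    rw [hdiff]
    refine (Finset.sum_le_sum fun i _ => hterm i).trans (le_of_eq ?_)
    rw [← hR, sum8_eq_sum]; push_cast
    rw [Finset.sum_div, Finset.sum_div]
    exact Finset.sum_congr rfl fun i _ => by field_simp
  have hcentre : memConst E cuts (cntList lo hi mems) + featRest E cuts Ts c ≤ (I'.hi : ℝ) / SC := by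
    rw [le_div_iff₀ hS]; exact hcI.2
  have h3 : ((I'.hi * (2 * (D : ℤ)) + R) * (q : ℤ) : ℝ) ≤ (p * (2 * (D : ℤ)) * (SC : ℤ) : ℝ) := by
    exact_mod_cast hsum
  push_cast at h3
  have key : (I'.hi : ℝ) / SC + (R : ℝ) / (2 * D) / SC ≤ (p : ℝ) / q := by
    rw [show (I'.hi : ℝ) / SC + (R : ℝ) / (2 * D) / SC = ((I'.hi : ℝ) * (2 * D) + R) / (2 * D * SC) by
      field_simp, div_le_div_iff₀ (by positivity) hq']
    nlinarith
  linarith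

/-- **KERNEL BOX BOUND FOR Φ.** If `wboxCheckN lo hi D E cuts mems p q = true` then `Φ(a) ≤ s₀(a)·(p/q)` for EVERY real
direction `a` of the closed box whose normalised parameters lie in the box: `lo_i ≤ (s_i(a)/s₀(a))·D ≤ hi_i` — by
`phi30_aOfS_le_winForm` (= P2 g24's `phi30_le_windows_members`) at the normalised direction, every hypothesis of which
is discharged from the integer box data, and `phi30_smul`. -/
theorem phi30_le_of_wboxCheck {lo hi : List ℕ} {D E : ℕ} {cuts : List ℕ} {mems : List (Fin 7 × Fin 7)} {p : ℤ}
    {q : ℕ} (hc : wboxCheckN lo hi D E cuts mems p q = true) {a : Dir} (ha : BZBox a)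
    (ht : ∀ i : Fin 8, ((lo.getD i 0 : ℕ) : ℝ) ≤ sParam a i / sParam a 0 * D ∧
      sParam a i / sParam a 0 * D ≤ ((hi.getD i 0 : ℕ) : ℝ)) :
    phi30 a ≤ sParam a 0 * ((p : ℝ) / q) := by
  have hwin := winForm_le_of_wboxCheck hc (t := fun i => sParam a i / sParam a 0) ht
  -- the hypotheses of P2's theorem on the box
  have hc' := hc
  unfold wboxCheckN at hc'
  simp only [Bool.and_eq_true, decide_eq_true_eq] at hc'
  obtain ⟨⟨⟨⟨hbox, _⟩, hcuts⟩, hwall⟩, _⟩ := hc'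
  obtain ⟨hD, hlo0, hhi0, hle⟩ := boxOK8_spec hbox
  simp only [cutsOK, Bool.and_eq_true, decide_eq_true_eq] at hcuts
  obtain ⟨⟨⟨⟨⟨hE, hA0⟩, hsort⟩, hlen⟩, _⟩, hmems⟩ := hcuts
  have hD' : (0 : ℝ) < D := by exact_mod_cast hD
  have hE' : (0 : ℝ) < E := by exact_mod_cast hE
  set s : Fin 8 → ℝ := fun i => sParam a i / sParam a 0 with hs
  have hs0 : s 0 = 1 := by simp [hs, div_self ha.1.ne']
  have hslo : ∀ j : Fin 7, 0 ≤ s j.succ := fun j => by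
    have h1 := (ht j.succ).1
    have h0 : (0 : ℝ) ≤ ((lo.getD j.succ 0 : ℕ) : ℝ) := Nat.cast_nonneg _
    exact nonneg_of_mul_nonneg_left (h0.trans h1) hD'
  have hshi : ∀ j : Fin 7, s j.succ ≤ s 0 := fun j => by
    have h1 := (ht j.succ).2
    have h2 : ((hi.getD j.succ 0 : ℕ) : ℝ) ≤ (D : ℝ) := by exact_mod_cast (hle j.succ).2
    rw [hs0]
    have : s j.succ * D ≤ 1 * D := by rw [one_mul]; exact h1.trans h2
    exact le_of_mul_le_mul_right this hD'
  have hU0 : (0 : ℝ) < ((cuts.getD 0 0 : ℕ) : ℝ) / E := by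
    have : (0 : ℝ) < ((cuts.getD 0 0 : ℕ) : ℝ) := by exact_mod_cast hA0
    positivity
  have hU : ∀ w < cuts.length - 1, ((cuts.getD w 0 : ℕ) : ℝ) / E ≤ ((cuts.getD (w + 1) 0 : ℕ) : ℝ) / E :=
    fun w hw => div_le_div_of_nonneg_right (by exact_mod_cast sortedLE_spec cuts hsort w (by omega)) hE'.le
  have hpq : ∀ w ≤ cuts.length - 1, (mems.getD w (0, 1)).1 ≠ (mems.getD w (0, 1)).2 :=
    fun w hw => mems_spec hmems (by omega)
  have hP2 := LemmaFWin.phi30_aOfS_le_winForm s (by rw [hs0]; exact one_pos) hslo hshi (cuts.length - 1)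
    (fun w => ((cuts.getD w 0 : ℕ) : ℝ) / E) hU0 (hh_of_wallOKBox hwall hD hE ht) hU
    (fun w => (mems.getD w (0, 1)).1) (fun w => (mems.getD w (0, 1)).2) hpq
  have e : phi30 a = sParam a 0 * phi30 (aOfS s) := by
    conv_lhs => rw [aOfS_normalise ha]
    rw [phi30_smul ha.1]
  rw [e]
  exact mul_le_mul_of_nonneg_left (hP2.trans hwin) ha.1.le

end LemmaFWinBox

end Summit.KontsevichZagierPeriods.Zeta5Search.Barrier.ConeGamma
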